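import Mathlib
import Literature.LinearAlgebra.Matrix.InverseMMatrixProofs
import HarnessLib

/-!
# Crux `PrecisionLaplacian.InverseMFerromagnet` (stmt-CriticalPhenomena-4798), line `Sketch` —
# stub `helper_strictlyUltrametric_inverse` (U1: strictly ultrametric matrices are potentials)

THEOREM-ONLY file (no definitions).

A real square matrix `U` is *strictly ultrametric* (Martínez–Michon–San Martín 1994;
Dellacherie–Martínez–San Martín 2014, Def. 3.2) if it is symmetric, entrywise nonnegative,
satisfies the ultrametric inequality `min (U i k) (U k j) ≤ U i j`, and is strictly row pointwise
diagonally dominant, `U i j < U i i` for `j ≠ i` (with `0 < U i i`).  THEOREM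
(`helper_strictlyUltrametric_inverse`, DMS 2014 Thm. 3.5 in the strict case; Nabben–Varga 1994):
such a `U` is nonsingular, `U⁻¹` is a Z-matrix (off-diagonal entries `≤ 0`) and `U⁻¹ 𝟙 ≥ 0`
(nonnegative inverse row sums), i.e. `U` is a *potential* in the sense of
`Literature.LinearAlgebra.Matrix.IsPotentialMatrix` (`su_isPotentialMatrix`).

PROOF (the linear-algebra induction of Nabben–Varga / DMS Prop. 3.4 + Thm. 3.5).  Strong induction
on the size.  Size `≤ 1`: `U = (u)` with `u > 0`.  Size `≥ 2`: let `τ = min U = U i₀ j₀`.  The set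
`S = {i | τ < U i₀ i}` contains `i₀` (strict dominance) and not `j₀`; for `i ∈ S`, `j ∉ S` the
ultrametric inequality `U i₀ j ≥ min (U i₀ i, U i j)` forces `U i j = τ` (`su_cross`).  Hence after
the reindexing `ι ≃ S ⊕ Sᶜ` (`Equiv.sumCompl`), `U = fromBlocks A' 0 0 B' + τ • 𝟙𝟙ᵀ` with
`A' = U|_S − τ`, `B' = U|_{Sᶜ} − τ` again strictly ultrametric of smaller sizes (positive diagonal
because `U i i > U i j₀ = τ`), so potentials by induction.  The block step (`su_blockStep`) is the
Sherman–Morrison identity (`su_rankOne_update_mul_eq_one`): with `D = A' ⊕ B'`, `E = D⁻¹`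
(symmetric, Z, `p = E𝟙 ≥ 0`, `s = 𝟙ᵀp`),
`(D + τ𝟙𝟙ᵀ)(E − τ/(1+τs) · ppᵀ) = 1`, whence `U⁻¹ = E − τ/(1+τs) · ppᵀ` is a Z-matrix and
`U⁻¹𝟙 = p/(1+τs) ≥ 0`.  Reindexing invariance is `IsPotentialMatrix.submatrix_equiv`.

References: C. Dellacherie, S. Martínez, J. San Martín, *Inverse M-Matrices and Ultrametric
Matrices*, LNM 2118, Springer 2014, Def. 3.2, Prop. 3.4, Thm. 3.5 [DellacherieMartinezSanmartin2014];
R. Nabben, R.S. Varga, SIAM J. Matrix Anal. Appl. 15 (1994) 107–113;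
S. Martínez, G. Michon, J. San Martín, SIAM J. Matrix Anal. Appl. 15 (1994) 98–106.
-/

namespace Summit.CriticalPhenomena.Ising3DConformalLimit.Cruxes.InverseMFerromagnet.PartialCovarianceLadder

open Finset Matrix
open Literature.LinearAlgebra.Matrix

noncomputable section

/-! ## Sherman–Morrison for the all-ones rank-one update -/

section RankOne

variable {m : Type} [Fintype m] [DecidableEq m]

/-- **Sherman–Morrison, all-ones update.**  If `D E = 1`, `p = E𝟙` equals the column sums of `E`
as well (e.g. `E` symmetric), `s = 𝟙ᵀ p` and `1 + τ s ≠ 0`, then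
`(D + τ 𝟙𝟙ᵀ) (E − τ/(1+τ s) · p pᵀ) = 1`. [folklore] -/
theorem su_rankOne_update_mul_eq_one (D E : Matrix m m ℝ) (hDE : D * E = 1) (p : m → ℝ)
    (hp : ∀ i, ∑ k, E i k = p i) (hq : ∀ j, ∑ k, E k j = p j) (s τ : ℝ) (hs : ∑ i, p i = s)
    (hτ : 1 + τ * s ≠ 0) :
    (D + τ • Matrix.of (fun _ _ : m => (1 : ℝ))) *
      (E - (τ / (1 + τ * s)) • Matrix.of (fun i j : m => p i * p j)) = 1 := by
  ext i j
  have hDE' : ∀ l, ∑ k, D i k * E k l = (1 : Matrix m m ℝ) i l := fun l => by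
    have h := congrFun (congrFun hDE i) l
    rwa [Matrix.mul_apply] at h
  have h2 : ∑ k, D i k * p k = 1 := by
    calc ∑ k, D i k * p k = ∑ k, ∑ l, D i k * E k l := by
          refine Finset.sum_congr rfl fun k _ => ?_
          rw [← hp k, Finset.mul_sum]
      _ = ∑ l, (1 : Matrix m m ℝ) i l := by
          rw [Finset.sum_comm]
          exact Finset.sum_congr rfl fun l _ => hDE' l
      _ = 1 := by simp [Matrix.one_apply]
  have expand : ∀ k, (D i k + τ • (1 : ℝ)) * (E k j - (τ / (1 + τ * s)) • (p k * p j))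
      = D i k * E k j + τ * E k j - (τ / (1 + τ * s) * p j) * (D i k * p k)
          - (τ * (τ / (1 + τ * s)) * p j) * p k := by
    intro k
    simp only [smul_eq_mul]
    ring
  simp only [Matrix.mul_apply, Matrix.add_apply, Matrix.sub_apply, Matrix.smul_apply,
    Matrix.of_apply]
  rw [Finset.sum_congr rfl (fun k _ => expand k), Finset.sum_sub_distrib, Finset.sum_sub_distrib,
    Finset.sum_add_distrib, ← Finset.mul_sum, ← Finset.mul_sum, ← Finset.mul_sum, hDE' j, hq j,
    h2, hs]
  field_simp
  ring

end RankOne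

/-! ## The block step: `A' ⊕ B' + τ 𝟙𝟙ᵀ` is a potential -/

section BlockStep

variable {S T : Type} [Fintype S] [DecidableEq S] [Fintype T] [DecidableEq T]

/-- **Block step** (DMS Thm. 3.5, proof; Nabben–Varga 1994).  If `A`, `B` are symmetric potentials
and `τ ≥ 0`, then `V = fromBlocks A 0 0 B + τ 𝟙𝟙ᵀ` is a potential: with `E = A⁻¹ ⊕ B⁻¹`,
`p = E𝟙 ≥ 0`, `s = 𝟙ᵀp`, Sherman–Morrison gives `V⁻¹ = E − τ/(1+τs) · ppᵀ` (a Z-matrix, as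
`E` is) and `V⁻¹𝟙 = p/(1+τs) ≥ 0`. [cite: DellacherieMartinezSanmartin2014, Thm. 3.5] -/
theorem su_blockStep (A : Matrix S S ℝ) (B : Matrix T T ℝ) (hA : IsPotentialMatrix A)
    (hB : IsPotentialMatrix B) (hAs : A.IsSymm) (hBs : B.IsSymm) {τ : ℝ} (hτ : 0 ≤ τ) :
    IsPotentialMatrix (Matrix.fromBlocks A 0 0 B + τ • Matrix.of (fun _ _ : S ⊕ T => (1 : ℝ))) := by
  -- `V` is entrywise nonnegative
  have hVnn : ∀ i j, 0 ≤ (Matrix.fromBlocks A 0 0 B + τ • Matrix.of (fun _ _ : S ⊕ T => (1 : ℝ))) i j := by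
    rintro (a | a) (b | b)
    · simp only [Matrix.add_apply, Matrix.fromBlocks_apply₁₁, Matrix.smul_apply, Matrix.of_apply,
        smul_eq_mul, mul_one]
      exact add_nonneg (hA.1.1 a b) hτ
    · simpa using hτ
    · simpa using hτ
    · simp only [Matrix.add_apply, Matrix.fromBlocks_apply₂₂, Matrix.smul_apply, Matrix.of_apply,
        smul_eq_mul, mul_one]
      exact add_nonneg (hB.1.1 a b) hτ
  set D : Matrix (S ⊕ T) (S ⊕ T) ℝ := Matrix.fromBlocks A 0 0 B with hD
  set E : Matrix (S ⊕ T) (S ⊕ T) ℝ := Matrix.fromBlocks A⁻¹ 0 0 B⁻¹ with hE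
  have hDE : D * E = 1 := by
    rw [hD, hE, Matrix.fromBlocks_multiply]
    simp [Matrix.mul_nonsing_inv _ hA.1.2.1, Matrix.mul_nonsing_inv _ hB.1.2.1,
      Matrix.fromBlocks_one]
  have hEs : E.IsSymm := by
    rw [hE]
    exact Matrix.IsSymm.fromBlocks hAs.inv (by simp) hBs.inv
  -- `p = E 𝟙`, the row sums of `E` (= row sums of `A⁻¹`, `B⁻¹`), nonnegative.
  set p : S ⊕ T → ℝ := fun i => ∑ k, E i k with hp_def
  have hp : ∀ i, ∑ k, E i k = p i := fun i => rfl
  have hq : ∀ j, ∑ k, E k j = p j := fun j =>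
    Finset.sum_congr rfl fun k _ => hEs.apply j k
  have hp_nonneg : ∀ i, 0 ≤ p i := by
    rintro (a | b)
    · simp only [hp_def, hE, Fintype.sum_sum_type, Matrix.fromBlocks_apply₁₁,
        Matrix.fromBlocks_apply₁₂, Matrix.zero_apply, Finset.sum_const_zero, add_zero]
      exact hA.2 a
    · simp only [hp_def, hE, Fintype.sum_sum_type, Matrix.fromBlocks_apply₂₁,
        Matrix.fromBlocks_apply₂₂, Matrix.zero_apply, Finset.sum_const_zero, zero_add]
      exact hB.2 b
  set s : ℝ := ∑ i, p i with hs_def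
  have hs : 0 ≤ s := Finset.sum_nonneg fun i _ => hp_nonneg i
  have hden : 0 < 1 + τ * s := by positivity
  have hc : 0 ≤ τ / (1 + τ * s) := div_nonneg hτ hden.le
  have hVW := su_rankOne_update_mul_eq_one D E hDE p hp hq s τ rfl hden.ne'
  -- `E` is a Z-matrix.
  have hEZ : ∀ i j, i ≠ j → E i j ≤ 0 := by
    rintro (a | a) (b | b) hab
    · simp only [hE, Matrix.fromBlocks_apply₁₁]
      exact hA.1.2.2 a b fun h => hab (congrArg Sum.inl h)
    · simp [hE]
    · simp [hE]
    · simp only [hE, Matrix.fromBlocks_apply₂₂]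
      exact hB.1.2.2 a b fun h => hab (congrArg Sum.inr h)
  refine ⟨⟨hVnn, Matrix.isUnit_det_of_right_inverse hVW, ?_⟩, ?_⟩
  · -- the inverse is a Z-matrix
    intro i j hij
    rw [Matrix.inv_eq_right_inv hVW, Matrix.sub_apply, Matrix.smul_apply, Matrix.of_apply,
      smul_eq_mul]
    have h1 := hEZ i j hij
    have h2 : 0 ≤ τ / (1 + τ * s) * (p i * p j) :=
      mul_nonneg hc (mul_nonneg (hp_nonneg i) (hp_nonneg j))
    linarith
  · -- nonnegative inverse row sums: `V⁻¹ 𝟙 = p / (1 + τ s)`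
    intro i
    rw [Matrix.inv_eq_right_inv hVW]
    simp only [Matrix.sub_apply, Matrix.smul_apply, Matrix.of_apply, smul_eq_mul]
    rw [Finset.sum_sub_distrib, hp i, ← Finset.mul_sum, ← Finset.mul_sum]
    have key : p i - τ / (1 + τ * s) * (p i * s) = p i / (1 + τ * s) := by
      field_simp
      ring
    rw [key]
    exact div_nonneg (hp_nonneg i) hden.le

end BlockStep

/-! ## Strictly ultrametric matrices are potentials (induction on the size) -/

section Main

/-- The cross entries: if `τ = min U`, `τ < U i₀ i` and `U i₀ j ≤ τ`, then `U i j = τ`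
(ultrametric inequality `U i₀ j ≥ min (U i₀ i, U i j)`); this is the constant block of
DMS Prop. 3.4. [cite: DellacherieMartinezSanmartin2014, Prop. 3.4] -/
theorem su_cross {ι : Type} (U : Matrix ι ι ℝ) (hult : ∀ i j k, min (U i k) (U k j) ≤ U i j)
    {τ : ℝ} (hτ : ∀ i j, τ ≤ U i j) {i₀ i j : ι} (hi : τ < U i₀ i) (hj : ¬ τ < U i₀ j) :
    U i j = τ :=
  le_antisymm (le_of_not_gt fun h => hj (lt_of_lt_of_le (lt_min hi h) (hult i₀ j i))) (hτ i j)

variable {ι : Type} [Fintype ι] [DecidableEq ι]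

/-- Size `≤ 1`: a `1 × 1` (or empty) matrix with positive diagonal is a potential. [folklore] -/
theorem su_isPotentialMatrix_subsingleton [Subsingleton ι] (U : Matrix ι ι ℝ)
    (hnn : ∀ i j, 0 ≤ U i j) (hpos : ∀ i, 0 < U i i) : IsPotentialMatrix U := by
  have hW : U * Matrix.of (fun i _ : ι => (U i i)⁻¹) = 1 := by
    ext i j
    obtain rfl : i = j := Subsingleton.elim i j
    rw [Matrix.mul_apply, Fintype.sum_subsingleton _ i, Matrix.of_apply, Matrix.one_apply_eq]
    exact mul_inv_cancel₀ (hpos i).ne'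
  refine ⟨⟨hnn, Matrix.isUnit_det_of_right_inverse hW, fun i j hij =>
    absurd (Subsingleton.elim i j) hij⟩, fun i => ?_⟩
  rw [Matrix.inv_eq_right_inv hW, Fintype.sum_subsingleton _ i, Matrix.of_apply]
  exact inv_nonneg.2 (hpos i).le

/-- **Strictly ultrametric ⇒ potential** (DMS Thm. 3.5, strict case; Nabben–Varga 1994), for an
arbitrary finite index type, by strong induction on its cardinality: the minimum `τ = U i₀ j₀`
splits the indices into `S = {i | τ < U i₀ i} ∋ i₀` and its complement `∋ j₀`, across which
`U ≡ τ`; subtracting `τ` leaves strictly ultrametric diagonal blocks, and the block step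
`su_blockStep` concludes. [cite: DellacherieMartinezSanmartin2014, Thm. 3.5] -/
theorem su_isPotentialMatrix_of_card : ∀ (N : ℕ) (ι : Type) [Fintype ι] [DecidableEq ι]
    (U : Matrix ι ι ℝ), Fintype.card ι = N → (∀ i j, U i j = U j i) → (∀ i j, 0 ≤ U i j) →
      (∀ i j k, min (U i k) (U k j) ≤ U i j) → (∀ i j, i ≠ j → U i j < U i i) →
        (∀ i, 0 < U i i) → IsPotentialMatrix U := by
  intro N
  induction N using Nat.strong_induction_on with
  | _ N ih =>
    intro ι _ _ U hN hsymm hnn hult hdom hpos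
    rcases subsingleton_or_nontrivial ι with hι | hι
    · exact su_isPotentialMatrix_subsingleton U hnn hpos
    -- the minimum `τ = U i₀ j₀`
    obtain ⟨⟨i₀, j₀⟩, hmin⟩ := Finite.exists_min (fun q : ι × ι => U q.1 q.2)
    set τ : ℝ := U i₀ j₀ with hτ_def
    have hτ : ∀ i j, τ ≤ U i j := fun i j => hmin (i, j)
    have hτ0 : 0 ≤ τ := hnn i₀ j₀
    -- the class `S = {i | τ < U i₀ i}` of `i₀` and its complement
    let P : ι → Prop := fun i => τ < U i₀ i
    have hi₀ : P i₀ := by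
      obtain ⟨k, hk⟩ := exists_ne i₀
      exact lt_of_le_of_lt (hτ i₀ k) (hdom i₀ k hk.symm)
    have hj₀ : ¬ P j₀ := lt_irrefl τ
    have cross : ∀ i j, P i → ¬ P j → U i j = τ := fun i j hi hj => su_cross U hult hτ hi hj
    have cross' : ∀ i j, ¬ P i → P j → U i j = τ := fun i j hi hj => by
      rw [hsymm]; exact cross j i hj hi
    -- the diagonal blocks, shifted by `τ`
    let A' : Matrix {a // P a} {a // P a} ℝ := Matrix.of fun a b => U a.1 b.1 - τ
    let B' : Matrix {a // ¬ P a} {a // ¬ P a} ℝ := Matrix.of fun a b => U a.1 b.1 - τ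
    have hcardA : Fintype.card {a // P a} < N := hN ▸ Fintype.card_subtype_lt hj₀
    have hcardB : Fintype.card {a // ¬ P a} < N :=
      hN ▸ Fintype.card_subtype_lt (p := fun a => ¬ P a) (x := i₀) (not_not.2 hi₀)
    have hA : IsPotentialMatrix A' := by
      refine ih _ hcardA {a // P a} A' rfl (fun a b => ?_) (fun a b => ?_) (fun a b c => ?_)
        (fun a b hab => ?_) (fun a => ?_)
      · simp only [A', Matrix.of_apply]
        rw [hsymm]
      · exact sub_nonneg.2 (hτ _ _)
      · simp only [A', Matrix.of_apply]
        rw [min_sub_sub_right]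
        exact sub_le_sub_right (hult _ _ _) _
      · exact sub_lt_sub_right (hdom _ _ fun h => hab (Subtype.ext h)) _
      · simp only [A', Matrix.of_apply, sub_pos]
        have hne : a.1 ≠ j₀ := fun h => hj₀ (h ▸ a.2)
        calc τ = U a.1 j₀ := (cross a.1 j₀ a.2 hj₀).symm
          _ < U a.1 a.1 := hdom _ _ hne
    have hB : IsPotentialMatrix B' := by
      refine ih _ hcardB {a // ¬ P a} B' rfl (fun a b => ?_) (fun a b => ?_) (fun a b c => ?_)
        (fun a b hab => ?_) (fun a => ?_)
      · simp only [B', Matrix.of_apply]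
        rw [hsymm]
      · exact sub_nonneg.2 (hτ _ _)
      · simp only [B', Matrix.of_apply]
        rw [min_sub_sub_right]
        exact sub_le_sub_right (hult _ _ _) _
      · exact sub_lt_sub_right (hdom _ _ fun h => hab (Subtype.ext h)) _
      · simp only [B', Matrix.of_apply, sub_pos]
        have hne : a.1 ≠ i₀ := fun h => a.2 (h ▸ hi₀)
        calc τ = U a.1 i₀ := (cross' a.1 i₀ a.2 hi₀).symm
          _ < U a.1 a.1 := hdom _ _ hne
    have hAs : A'.IsSymm := Matrix.IsSymm.ext fun a b => by
      simp only [A', Matrix.of_apply]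
      rw [hsymm]
    have hBs : B'.IsSymm := Matrix.IsSymm.ext fun a b => by
      simp only [B', Matrix.of_apply]
      rw [hsymm]
    -- the block form of `U` after reindexing along `e : S ⊕ Sᶜ ≃ ι`
    have hV := su_blockStep A' B' hA hB hAs hBs hτ0
    let e : {a // P a} ⊕ {a // ¬ P a} ≃ ι := Equiv.sumCompl P
    have hUe : U.submatrix e e
        = Matrix.fromBlocks A' 0 0 B' + τ • Matrix.of (fun _ _ => (1 : ℝ)) := by
      ext (a | a) (b | b)
      · simp [e, A']
      · simp [e, cross a.1 b.1 a.2 b.2]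
      · simp [e, cross' a.1 b.1 a.2 b.2]
      · simp [e, B']
    rw [← hUe] at hV
    have hU := hV.submatrix_equiv e.symm
    simpa only [Matrix.submatrix_submatrix, Equiv.self_comp_symm, Matrix.submatrix_id_id] using hU

/-- **Strictly ultrametric ⇒ potential**, for any finite index type: a symmetric, nonnegative,
ultrametric, strictly row pointwise diagonally dominant real matrix with positive diagonal is a
potential matrix (nonsingular, `U⁻¹` a Z-matrix, `U⁻¹𝟙 ≥ 0`).
[cite: DellacherieMartinezSanmartin2014, Thm. 3.5] -/
theorem su_isPotentialMatrix (U : Matrix ι ι ℝ) (hsymm : ∀ i j, U i j = U j i)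
    (hnn : ∀ i j, 0 ≤ U i j) (hult : ∀ i j k, min (U i k) (U k j) ≤ U i j)
    (hdom : ∀ i j, i ≠ j → U i j < U i i) (hpos : ∀ i, 0 < U i i) : IsPotentialMatrix U :=
  su_isPotentialMatrix_of_card _ ι U rfl hsymm hnn hult hdom hpos

end Main

/-- **U1 · `helper_strictlyUltrametric_inverse` — strictly ultrametric matrices are inverse
M-matrices with nonnegative inverse row sums** (Martínez–Michon–San Martín 1994; linear-algebra
proof of Nabben–Varga 1994; DMS 2014, Thm. 3.5).  A real `n × n` matrix `U` that is symmetric,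
entrywise nonnegative, ultrametric (`min(U_ik, U_kj) ≤ U_ij` for all `k`), strictly
row-diagonally dominant (`U_ij < U_ii` for `j ≠ i`) and has positive diagonal is nonsingular, its
inverse has nonpositive off-diagonal entries, and the row sums of the inverse are nonnegative.
[cite: DellacherieMartinezSanmartin2014, Thm. 3.5] -/
theorem helper_strictlyUltrametric_inverse :
    ∀ (n : ℕ) (U : Matrix (Fin n) (Fin n) ℝ), (∀ i j, U i j = U j i) → (∀ i j, 0 ≤ U i j) →
      (∀ i j k, min (U i k) (U k j) ≤ U i j) → (∀ i j, i ≠ j → U i j < U i i) → (∀ i, 0 < U i i) →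
        U.det ≠ 0 ∧ (∀ i j, i ≠ j → U⁻¹ i j ≤ 0) ∧ (∀ i, 0 ≤ ∑ j, U⁻¹ i j) := by
  intro n U hsymm hnn hult hdom hpos
  have h := su_isPotentialMatrix U hsymm hnn hult hdom hpos
  exact ⟨h.1.2.1.ne_zero, h.1.2.2, h.2⟩

end

end Summit.CriticalPhenomena.Ising3DConformalLimit.Cruxes.InverseMFerromagnet.PartialCovarianceLadder
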